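import Summits.BirchSwinnertonDyer.Rank1Residual.X12.JZeroThreeTorsionCriterion
import Summits.BirchSwinnertonDyer.Rank1Residual.X12.O11.RamifiedStrictDescentAtThreeLeaf
import Summits.BirchSwinnertonDyer.Rank1Residual.X12.JZeroThreeDescent
import HarnessLib

/-!
# Route PrintCFram, crux C1 `CMRamifiedThreeBSD` — child E by a CONGRUENCE: `BSD(W, 3)` from (R-EU)₃
# for every `j = 0` curve whose Mordell coefficient `k = 3ᵃm` has `(−1)ᵃ m ≡ 2 (mod 3)`
# (cell `bsd-print-cfram`, seat p4; supports stmt-BirchSwinnertonDyer-20371)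

HONEST FRAMING (cell `bsd-print-cfram`, run/shared/lean/pub/bsd-print-cfram/, D-0131 (2) print
tier; verbatim in every file of the seat): the cell works the partition leaf
`CornerF ∧ p ramified in the CM field K` (LADDER-BSD row K7r = B13; W-ALL row 12r) in PARTITION
currency — a leaf or a cell counts only when its theorem is in the kernel BY NAME. Nothing is
closed here: this file COMPOSES ty2's curve-by-curve consumer at `3`
(`X12.O11.bsdp_three_of_ellipticUnitIndexAtThree`, p543426: `BSD(W, 3)` ⟸ {modularity, GZ I.(7.3),
GZK, Cassels} + CM + `3` ramified + `r_an = 1` + the two `ℚ₃`-torsion binders `htors`/`htw` + the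
away binder `hℓ` + (R-EU)₃) with this seat's `3`-torsion criterion
(`X12.JZeroThree.noThreeTorsion_pair_iff_of_mordell_model`, p546152): the binders `htors ∧ htw` are
DISCHARGED from a congruence on a Mordell model `C • W = (y² = x³ + 3ᵃ·m)`, `3 ∤ m` —
`(a even ∧ m ≡ 2 (mod 3)) ∨ (a odd ∧ m ≡ 1 (mod 3))`, i.e. `χ_{d*}(3) = −1` = Kriz–Li's (1) — and
CM / `3`-ramified come for free from `j = 0`. So the planner's CHILD E of C1 reads, member by
member: «Mordell datum + congruence + `3 ∤ c_ℓ` at bad `ℓ ≡ 1 (3)` + (R-EU)₃ ⟹ BSD(W, 3)», and its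
complement CHILD X (`k ∈ ℚ₃ײ` or `−3k ∈ ℚ₃ײ`; all cube-sum curves) is decided by the same
congruence. The residual (R-EU)₃ (`RamifiedCMEllipticUnitIndexAtThree`, CONSTRUCTION / OPEN, no
print at `p = 3 ∣ #𝓞_K^×`) is untouched. Theorems only; no named fact. beyond-print: NO.

References: `X12/JZeroThreeTorsionCriterion.lean`; `X12/O11/RamifiedStrictDescentAtThreeLeaf.lean`;
`X12/JZeroThreeDescent.lean`; [cite: Miller2011LMS, §1 and Def. 1.1]; [cite: SilvermanAEC2009, Exercise 3.7 and X.5];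
[cite: KrizLi2019, Thm. 1.20 hypothesis (1)].
-/

set_option linter.dupNamespace false
set_option autoImplicit false

noncomputable section

open scoped Classical

open WeierstrassCurve Literature.NumberTheory.EllipticCurves
  Literature.NumberTheory.EllipticCurves.ModularForms
  Literature.NumberTheory.EllipticCurves.Rank1Residual
  Summit.BirchSwinnertonDyer.Rank1Residual Summit.BirchSwinnertonDyer.Rank1Residual.X12

namespace Summit.BirchSwinnertonDyer.BirchSwinnertonDyer.Theorems.PrintCFram

/-- A curve with a Mordell model `C • W = (y² = x³ + k)` has `j = 0` (`c₄` is a weight-`4`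
semi-invariant and `c₄(y² = x³ + k) = 0`). [cite: SilvermanAEC2009, III.1 Table 3.1] -/
theorem j_eq_zero_of_mordell_model {W : WeierstrassCurve ℚ} [W.IsElliptic] {C : VariableChange ℚ}
    {k : ℚ} (hW : C • W = mordellCurve k) : W.j = 0 := by
  apply j_eq_zero
  have h := variableChange_c₄ W C
  rw [hW, mordellCurve_c₄] at h
  have hu : ((C.u⁻¹ : ℚˣ) : ℚ) ^ 4 ≠ 0 := pow_ne_zero _ (Units.ne_zero _)
  rcases mul_eq_zero.mp h.symm with h0 | h0
  · exact (hu h0).elim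
  · exact h0

/-- **CHILD E of the crux C1, member by member, with the `ℚ₃`-torsion binders discharged by the
congruence.** Let `W/ℚ` be a globally minimal curve with a Mordell model `C • W = (y² = x³ + 3ᵃ·m)`,
`3 ∤ m`, satisfying `(a even ∧ m ≡ 2 (mod 3)) ∨ (a odd ∧ m ≡ 1 (mod 3))` (⟺ `W(ℚ₃)[3] = 0` and
`W^{(−3)}(ℚ₃)[3] = 0`, `noThreeTorsion_pair_iff_of_mordell_model`), of analytic rank one, with
`W(ℚ_ℓ)[3] = 0` at every bad `ℓ ≠ 3` with `√−3 ∈ ℚ_ℓ` (`hℓ`: `3 ∤ c_ℓ` at bad `ℓ ≡ 1 (mod 3)`).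
Then (R-EU)₃ at `W` (`h3`, the residual) gives `BSD(W, 3)` — granted modularity, Gross–Zagier
I.(7.3), GZK and Cassels. CM and `3`-ramified are derived from `j = 0`. Nothing asserted about any
curve; (R-EU)₃ stays OPEN. [cite: Miller2011LMS, §1 and Def. 1.1] [cite: KrizLi2019, Thm. 1.20 hypothesis (1)] -/
theorem bsdp_three_of_ellipticUnitIndexAtThree_of_criterion
    (hmod : hasEntireLFunction_rat) (hGZ : GrossZagier1986_thm_I_7_3)
    (hGZK : rank_eq_analyticRank_of_analyticRank_le_one) (hCassels : bsdRHS_eq_of_isIsogenous)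
    {W : WeierstrassCurve ℚ} [W.IsElliptic] [W.IsGloballyMinimal] {C : VariableChange ℚ}
    {a : ℕ} {m : ℤ} (hm : ¬ (3 : ℤ) ∣ m)
    (hW : C • W = mordellCurve ((((3 : ℤ) ^ a * m : ℤ)) : ℚ))
    (hcrit : (Even a ∧ (m : ZMod 3) = 2) ∨ (Odd a ∧ (m : ZMod 3) = 1))
    (hr : W.analyticRank = 1)
    (hℓ : ∀ (ℓ : ℕ) [Fact ℓ.Prime], ℓ ≠ 3 → (∃ y : ℚ_[ℓ], y ^ 2 = -3) → ¬ Good W ℓ →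
      ∀ Q : (W.baseChange ℚ_[ℓ]).toAffine.Point, (3 : ℕ) • Q = 0 → Q = 0)
    (h3 : O11.RamifiedCMEllipticUnitIndexAtThree W) : BSDp W 3 := by
  have hj : W.j = 0 := j_eq_zero_of_mordell_model hW
  obtain ⟨htors, htw⟩ := (JZeroThree.noThreeTorsion_pair_iff_of_mordell_model W hm hW).mpr hcrit
  exact O11.bsdp_three_of_ellipticUnitIndexAtThree hmod hGZ hGZK hCassels (W.hasCM_of_j_eq_zero hj)
    (JZeroThree.cmRamified_three_of_j_eq_zero W hj) hr htors htw hℓ h3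

/-- **CHILD X is where the binders FAIL**: if the congruence fails (`k ∈ ℚ₃ײ` or `−3k ∈ ℚ₃ײ`),
then `W` or `W^{(−3)}` HAS a `ℚ₃`-rational point of order `3`, so ty2's O11@3 consumer does not apply
to `W` as typed — the class belongs to the planner's child X (every cube-sum curve `x³ + y³ = n` is
here: `k = −432n²`). [cite: SilvermanAEC2009, Exercise 3.7 and X.5] -/
theorem not_noThreeTorsion_pair_of_not_criterion (W : WeierstrassCurve ℚ) {C : VariableChange ℚ}
    {a : ℕ} {m : ℤ} (hm : ¬ (3 : ℤ) ∣ m)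
    (hW : C • W = mordellCurve ((((3 : ℤ) ^ a * m : ℤ)) : ℚ))
    (hcrit : ¬ ((Even a ∧ (m : ZMod 3) = 2) ∨ (Odd a ∧ (m : ZMod 3) = 1))) :
    ¬ ((∀ Q : (W.baseChange ℚ_[3]).toAffine.Point, (3 : ℕ) • Q = 0 → Q = 0) ∧
      (∀ Q : ((W.quadraticTwist (-3 : ℚ)).baseChange ℚ_[3]).toAffine.Point,
        (3 : ℕ) • Q = 0 → Q = 0)) :=
  fun h ↦ hcrit ((JZeroThree.noThreeTorsion_pair_iff_of_mordell_model W hm hW).mp h)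

/-- **Every cube-sum curve is in child X.** For `n = 3ᵉ·n'` with `3 ∤ n'` the Mordell coefficient of
`x³ + y³ = n`, `k = −432n² = 3^{3+2e}·(−16n'²)`, has odd `3`-valuation and `3`-free part
`−16n'² ≡ 2 (mod 3)` — the congruence of child E fails. (Pure arithmetic; stated on the exponent /
unit pair.) [folklore] -/
theorem not_criterion_cubeSum (e : ℕ) {n' : ℤ} (hn : ¬ (3 : ℤ) ∣ n') :
    ¬ ((Even (3 + 2 * e) ∧ ((-16 * n' ^ 2 : ℤ) : ZMod 3) = 2) ∨
      (Odd (3 + 2 * e) ∧ ((-16 * n' ^ 2 : ℤ) : ZMod 3) = 1)) := by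
  have hodd : Odd (3 + 2 * e) := ⟨e + 1, by ring⟩
  have hne : ¬ Even (3 + 2 * e) := Nat.not_even_iff_odd.mpr hodd
  have hz : ((n' : ℤ) : ZMod 3) ≠ 0 := by
    rwa [Ne, ZMod.intCast_zmod_eq_zero_iff_dvd]
  have hsq : ((-16 * n' ^ 2 : ℤ) : ZMod 3) = 2 := by
    have h12 : ∀ z : ZMod 3, z ≠ 0 → (-16 : ZMod 3) * z ^ 2 = 2 := by decide
    push_cast
    exact h12 _ hz
  rintro (⟨he, -⟩ | ⟨-, h1⟩)
  · exact hne he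
  · rw [hsq] at h1; exact absurd h1 (by decide)

/-- **Kriz–Li's sextic twists sit in child E exactly by their printed congruence, case `3 ∤ d`:**
for `E_d : y² = x³ − 432d = x³ + 3³·(−16d)` the child-E congruence (odd exponent `3`, unit part
`−16d ≡ 1 (mod 3)`) is `d ≡ 2 (mod 3)` — Kriz–Li Thm 1.23's «`d ≡ 2 (mod 3)`» (⟺ `ψ_d(3) ≠ 1`).
[cite: KrizLi2019, Thm. 1.23 (2) and proof of Thm. 10.6] -/
theorem criterion_sextic_of_not_three_dvd {d : ℤ} (hd : ¬ (3 : ℤ) ∣ d) :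
    ((Even 3 ∧ ((-16 * d : ℤ) : ZMod 3) = 2) ∨ (Odd 3 ∧ ((-16 * d : ℤ) : ZMod 3) = 1)) ↔
      (d : ZMod 3) = 2 := by
  have hz : ((d : ℤ) : ZMod 3) ≠ 0 := by rwa [Ne, ZMod.intCast_zmod_eq_zero_iff_dvd]
  have h3 : ¬ Even 3 := by decide
  have o3 : Odd 3 := by decide
  have key : ∀ z : ZMod 3, z ≠ 0 → ((-16 : ZMod 3) * z = 1 ↔ z = 2) := by decide
  push_cast
  simp only [h3, false_and, false_or, o3, true_and]
  exact key _ hz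

/-- **Case `3 ∥ d`, `d = 3d'`:** `E_d : y² = x³ − 432·3d' = x³ + 3⁴·(−16d')`; the congruence (even
exponent `4`, unit part `−16d' ≡ 2 (mod 3)`) is `d' ≡ 1 (mod 3)`, i.e. `d ≡ 3 (mod 9)` — Kriz–Li's
«`d ≡ 3 (mod 9)`». [cite: KrizLi2019, Thm. 1.23 (2) and proof of Thm. 10.6] -/
theorem criterion_sextic_of_three_dvd {d' : ℤ} (hd : ¬ (3 : ℤ) ∣ d') :
    ((Even 4 ∧ ((-16 * d' : ℤ) : ZMod 3) = 2) ∨ (Odd 4 ∧ ((-16 * d' : ℤ) : ZMod 3) = 1)) ↔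
      (d' : ZMod 3) = 1 := by
  have hz : ((d' : ℤ) : ZMod 3) ≠ 0 := by rwa [Ne, ZMod.intCast_zmod_eq_zero_iff_dvd]
  have e4 : Even 4 := by decide
  have o4 : ¬ Odd 4 := by decide
  have key : ∀ z : ZMod 3, z ≠ 0 → ((-16 : ZMod 3) * z = 2 ↔ z = 1) := by decide
  push_cast
  simp only [e4, true_and, o4, false_and, or_false]
  exact key _ hz

/-! ## APPEND ⟦p4 g2, 17:45Z⟧ — the criterion against the FRAME twin `W'` of the route's regime items

The regime items N/T/V of route rev 6 quantify over ty2's `3`-frames `IsFrameThree W K 𝔭 W' C'`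
(`W' = C' • W^{(−3)}`, any model of the twist), not over `W^{(−3)}` itself; since "no `ℚ₃`-rational
`3`-torsion" is model-invariant (`JZeroThree.noThreeTorsion_baseChange_iff_of_smul_eq`), the criterion
reads the same on every frame. -/

/-- **The `3`-torsion criterion on a `3`-frame.** For a `3`-frame `(K, 𝔭, W', C')` of `W` (ty2's
`X12.O11.IsFrameThree`: `W' = C' • W^{(−3)}`) and a Mordell model `C • W = (y² = x³ + 3ᵃ·m)`,
`3 ∤ m`: the regime-N binders «no `ℚ₃`-rational point of order `3` on `W` and on `W'`» hold iff
`(a even ∧ m ≡ 2 (mod 3)) ∨ (a odd ∧ m ≡ 1 (mod 3))`; their failure is regime T's hypothesis.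
[cite: SilvermanAEC2009, Exercise 3.7 and X.5] -/
theorem frame_noThreeTorsion_pair_iff_criterion {W : WeierstrassCurve ℚ} [W.IsElliptic]
    {K : Type} [Field K] [NumberField K]
    {𝔭 : IsDedekindDomain.HeightOneSpectrum (NumberField.RingOfIntegers K)}
    {W' : WeierstrassCurve ℚ} {C' : VariableChange ℚ} (hF : O11.IsFrameThree W K 𝔭 W' C')
    {C : VariableChange ℚ} {a : ℕ} {m : ℤ} (hm : ¬ (3 : ℤ) ∣ m)
    (hW : C • W = mordellCurve ((((3 : ℤ) ^ a * m : ℤ)) : ℚ)) :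
    ((∀ Q : (W.baseChange ℚ_[3]).toAffine.Point, (3 : ℕ) • Q = 0 → Q = 0) ∧
      (∀ Q : (W'.baseChange ℚ_[3]).toAffine.Point, (3 : ℕ) • Q = 0 → Q = 0)) ↔
      ((Even a ∧ (m : ZMod 3) = 2) ∨ (Odd a ∧ (m : ZMod 3) = 1)) := by
  rw [← JZeroThree.noThreeTorsion_baseChange_iff_of_smul_eq hF.twist_eq ℚ_[3]]
  exact JZeroThree.noThreeTorsion_pair_iff_of_mordell_model W hm hW

/-- **Regime T's hypothesis on a frame, as the failure of the congruence**: `W` or the frame twin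
`W'` has a non-zero `ℚ₃`-rational point of order `3` iff NOT `((a even ∧ m ≡ 2) ∨ (a odd ∧ m ≡ 1))`.
[cite: SilvermanAEC2009, Exercise 3.7 and X.5] -/
theorem frame_exists_threeTorsion_iff_not_criterion {W : WeierstrassCurve ℚ} [W.IsElliptic]
    {K : Type} [Field K] [NumberField K]
    {𝔭 : IsDedekindDomain.HeightOneSpectrum (NumberField.RingOfIntegers K)}
    {W' : WeierstrassCurve ℚ} {C' : VariableChange ℚ} (hF : O11.IsFrameThree W K 𝔭 W' C')
    {C : VariableChange ℚ} {a : ℕ} {m : ℤ} (hm : ¬ (3 : ℤ) ∣ m)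
    (hW : C • W = mordellCurve ((((3 : ℤ) ^ a * m : ℤ)) : ℚ)) :
    ((∃ Q : (W.baseChange ℚ_[3]).toAffine.Point, (3 : ℕ) • Q = 0 ∧ Q ≠ 0) ∨
      (∃ Q : (W'.baseChange ℚ_[3]).toAffine.Point, (3 : ℕ) • Q = 0 ∧ Q ≠ 0)) ↔
      ¬ ((Even a ∧ (m : ZMod 3) = 2) ∨ (Odd a ∧ (m : ZMod 3) = 1)) := by
  rw [← frame_noThreeTorsion_pair_iff_criterion hF hm hW]
  constructor
  · rintro (⟨Q, hQ, hQ0⟩ | ⟨Q, hQ, hQ0⟩) ⟨h1, h2⟩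
    · exact hQ0 (h1 Q hQ)
    · exact hQ0 (h2 Q hQ)
  · intro h
    by_contra hne
    apply h
    refine ⟨fun Q hQ ↦ ?_, fun Q hQ ↦ ?_⟩
    · by_contra hQ0; exact hne (Or.inl ⟨Q, hQ, hQ0⟩)
    · by_contra hQ0; exact hne (Or.inr ⟨Q, hQ, hQ0⟩)

end Summit.BirchSwinnertonDyer.BirchSwinnertonDyer.Theorems.PrintCFram

end
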